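import Summits.Ventures.HodgeRepro2.A2ModelConjugation
import Summits.Ventures.HodgeRepro2.A2TheoremAClassModel

/-!
# A2TheoremAClassReal — Theorem A's class `y = z ⋆ θ^4` is a real `(2,2)`-class of the model

Tier-4 annex of sub-claim A2 (seat p6, cell pub-hodge-repro2); §8(d): uses an L-value-free
non-vanishing device: NO.

The record of row 119 (`A2TheoremAClassModel`) lists what the model knows about Theorem A's
class `y = z ⋆ θ^4` (`z ∈ ⋀^20` the surface class, `θ = Σ c_p E_p` the `(1,1)`-class of (S2));
row 121 adds its bidegree `(2,2)`.  With the complex conjugation of row 132 the REALITY of `y`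
is in kernel too:

* `conjA_theta_of_imaginary`: `θ_c` is real exactly when its eigen-coordinates are purely
  imaginary (`c̄_p = −c_p`) — the model's normalisation `E_p = a_p ∧ b_p = ℓ_τ ∧ ℓ_τ̄` makes
  `conjA E_p = −E_p`, as for `i dz ∧ dz̄`;
* `theoremA_class_real_two_two` (twelve planes): for a real surface class `z` of bidegree
  `(10,10)` and a `θ` with purely imaginary coordinates, `y = z ⋆ θ^4` is a REAL `(2,2)`-class —
  the model's form of «`y ∈ H^{2,2}(B) ∩ H^4(B, ℝ)`» (the rationality of `y`, which makes it a
  Hodge class, is the algebraicity (S3) / Lemma A0.5 and stays prose).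

What stays prose: the identification of the model with `H^*(B, ℂ)` and the rational structure;
not on the N1 chain.
-/

namespace Summit.Ventures.HodgeRepro2.A2TheoremAClassReal

open WeilPlanes WeilIntegral WeilCoproduct A2ModelDuality A2PontryaginModel A2HodgeTypeModel
  A2ModelConjugation

variable {ι : Type*} [DecidableEq ι] [Fintype ι]

/-- `θ_c` is real when its coordinates are purely imaginary: `c̄_p = −c_p` for all `p`. -/
theorem conjA_theta_of_imaginary {c : ι → ℂ} (hc : ∀ p, (starRingEnd ℂ) (c p) = -c p) :
    conjA (theta c) = theta c := by
  rw [conjA_theta]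
  simp only [theta, hc, neg_smul, Finset.sum_neg_distrib, neg_neg]

/-- Conversely a real `θ_c` has purely imaginary coordinates (the `E_p` are linearly
independent: `∫_B E_p ∧ E_{univ ∖ {p}} = vol ≠ 0`). -/
theorem imaginary_of_conjA_theta {c : ι → ℂ} (h : conjA (theta c) = theta c) (p : ι) :
    (starRingEnd ℂ) (c p) = -c p := by
  rw [conjA_theta] at h
  -- pair both sides with `E_{univ ∖ {p}}` (row 117's `integral_ET_mul_ET`)
  have key : ∀ d : ι → ℂ, integral (theta d * ET (Finset.univ \ {p})) = d p * vol ι := by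
    intro d
    simp only [theta, Finset.sum_mul, map_sum, smul_mul_assoc, map_smul, smul_eq_mul]
    rw [Finset.sum_eq_single p]
    · rw [← A2PrimitivePart.ET_singleton, A2PontryaginFullPlane.integral_ET_mul_ET, if_pos rfl]
    · intro q _ hq
      rw [← A2PrimitivePart.ET_singleton, A2PontryaginFullPlane.integral_ET_mul_ET, if_neg, mul_zero]
      intro hsd
      have hp : p ∈ Finset.univ \ {q} := by
        rw [Finset.mem_sdiff, Finset.mem_singleton]
        exact ⟨Finset.mem_univ p, Ne.symm hq⟩
      rw [← hsd, Finset.mem_sdiff, Finset.mem_singleton] at hp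
      exact hp.2 rfl
    · intro hp
      exact absurd (Finset.mem_univ p) hp
  have h1 := congrArg (fun w => integral (w * ET (Finset.univ \ {p}))) h
  simp only [neg_mul, map_neg, key] at h1
  have hv := vol_ne_zero ι
  have h2 : (starRingEnd ℂ) (c p) * vol ι = (-c p) * vol ι := by
    rw [neg_mul, ← h1, neg_neg]
  exact mul_right_cancel₀ hv h2

/-- `θ_c^k` is real for purely imaginary coordinates. -/
theorem conjA_theta_pow_of_imaginary {c : ι → ℂ} (hc : ∀ p, (starRingEnd ℂ) (c p) = -c p)
    (k : ℕ) : conjA (theta c ^ k) = theta c ^ k := by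
  induction k with
  | zero => simp [conjA_one]
  | succ k ih => rw [pow_succ, conjA_mul, ih, conjA_theta_of_imaginary hc]

/-- THEOREM A's CLASS IS A REAL `(2,2)`-CLASS (twelve planes): for a real surface class `z` of
bidegree `(10,10)` and `θ` with purely imaginary coordinates, `y = z ⋆ θ^4` satisfies
`conjA y = y` and `y ∈ hgrading 2 2`. -/
theorem theoremA_class_real_two_two {c : A2TwelvePlanes.ι₁₂ → ℂ} (hc : ∀ p, c p ≠ 0)
    (hci : ∀ p, (starRingEnd ℂ) (c p) = -c p) {z : A A2TwelvePlanes.ι₁₂} (hz : conjA z = z)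
    (hz' : z ∈ hgrading 10 10) :
    conjA (pontryagin z (theta c ^ 4)) = pontryagin z (theta c ^ 4) ∧
      pontryagin z (theta c ^ 4) ∈ hgrading 2 2 :=
  ⟨conjA_pontryagin_eq_self ⟨6, by rw [A2TwelvePlanes.card_twelve]⟩ hz
      (conjA_theta_pow_of_imaginary hci 4),
    A2HodgeTypeModel.pontryagin_theta_pow_four_mem_two_two hc hz'⟩

end Summit.Ventures.HodgeRepro2.A2TheoremAClassReal
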